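import Mathlib
import Summits.Ventures.PercRepro2.Independence
import Summits.Ventures.PercRepro2.Harris
import Summits.Ventures.PercRepro2.HCov
import Summits.Ventures.PercRepro2.CutVertexPaths
import Summits.Ventures.PercRepro2.CutOneFarConn
import Summits.Ventures.PercRepro2.CutTwoFarConn
import Summits.Ventures.PercRepro2.CutTwoFarLaw
import Summits.Ventures.PercRepro2.CutTwoFar
import Summits.Ventures.PercRepro2.CutTwoFarHarris
import Summits.Ventures.PercRepro2.CutTwoFarRootsLaw
import Summits.Ventures.PercRepro2.CutTwoFarRightPat
import Summits.Ventures.PercRepro2.RootLeafO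
import Summits.Ventures.PercRepro2.CutTwoFarROConn
import Summits.Ventures.PercRepro2.CutTwoFarROMasses
import Summits.Ventures.PercRepro2.CutTwoFarRO
import Summits.Ventures.PercRepro2.CutTwoFarROSigns

/-!
# A root and `o` behind a cut vertex, V: THE CLASS THEOREM (blind cell PercRepro2, typer-1 g50)

The last endpoint number of the T6 reduction, `γₒ(1)`, is nonnegative: by MINE2-CUTVERTEX §13.13,
`γₒ(1) = 2 [ r²·(L6) + n₃ · r · α_b + P(Q′, b ↔ v) · (D′ b₃ − n₃ π) ]` — an exact identity in the
right atoms (`gamma1_ro_eq`; the relation `Q′ = (a₃ ∈ C(v)) ⊔ (a₃ ∈ C(a₂)) ⊔ (a₃ ∉ U′)` and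
`β_b = P(Q′, bH) − P(Q′, bH, 3L)` are automatic in the atom language) — where `r²·(L6) ≥ 0` is
mine-2's root-far lemma (L6) in the kernel (`RootLeafO.rootleaf_o_nonneg`, row 2′ROOTLEAF-o) and
`D′ b₃ − n₃ π = P(A) P(B) − P(A ∩ B) ≥ 0` is Harris for the decreasing `A = {v ↮ a₂, a₃ ↮ v}`
against the increasing `B = {a₃ ↔ a₂}` (`M_ro_nonneg`).  Hence **`HCov_a1oFar`**: (HCOV) holds
unconditionally on the class `{a₁, o}` of S3.5 (a root and `o` behind a cut vertex, any weighted
part on either side, every admissible weight vector) — the FIFTH two-far-mark class in the kernel.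
Own work; standard axioms.
-/

namespace Summit.Ventures.PercRepro2

open CovForm CutVertexM9 UnionCluster

namespace CutTwoFar

section ROFull

variable {V : Type*} {E : Type*} [Fintype E] [DecidableEq E] {R : Type*} [Field R]
variable {ends : E → Sym2 V} {side : E → Bool} {L : Set V} {v : V} {Rt : Set V}

variable (h : CutVertex ends side L v Rt) {o b a₁ a₂ a₃ : V} (p : E → R)
include h

omit [Fintype E] [DecidableEq E] in
/-- `v ↔ a₃`, the orientation of (L6)'s `X₃`. -/
lemma ro_conn_v_a₃' (h3 : a₃ ∈ Rt ∨ a₃ = v) (ω : Config E) :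
    Conn ends ω v a₃ ↔ rpat ends side v a₂ a₃ b ω 1 = true := by
  rw [conn_right_iff h (Or.inr rfl) h3 ω, rpat_one_iff]

/-- A quantity of (L6) / the Harris step, in the right atoms: `l6_Rx3N`. -/
theorem l6_Rx3N [DecidableEq V] (h2 : a₂ ∈ Rt ∨ a₂ = v) (h3 : a₃ ∈ Rt ∨ a₃ = v) : prob p (avoidAll ends a₂ {v, a₃} ∩ (connEvent ends v a₃)ᶜ) =
    ratom ends side v a₂ a₃ b p ![false, false, true, false, false, false] + ratom ends side v a₂ a₃ b p ![false, false, false, false, true, false] + ratom ends side v a₂ a₃ b p ![false, false, false, false, false, true] + ratom ends side v a₂ a₃ b p ![false, false, false, false, false, false] := by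
  rw [prob_R6 ends side v a₂ a₃ b p ((avoidAll ends a₂ {v, a₃} ∩ (connEvent ends v a₃)ᶜ))
      (fun ρ => (¬ (ρ 0 = true) ∧ ¬ (ρ 3 = true)) ∧ ¬ (ρ 1 = true)) (fun ω => by simp only [Set.mem_inter_iff, Set.mem_compl_iff, mem_connEvent, avoidAll, Set.mem_setOf_eq, Finset.mem_insert, Finset.mem_singleton, forall_eq_or_imp, forall_eq, ro_conn_a₂_v h h2 ω (a₃ := a₃) (b := b), ro_conn_a₂_a₃ h h2 h3 ω (b := b), ro_conn_v_a₃' h h3 ω (a₂ := a₂) (b := b)])]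
  simp only [sum_ite_ratom_eq_sum_transSix, sum_transSix]
  conv_lhs => simp [Fintype.sum_prod_type]

/-- A quantity of (L6) / the Harris step, in the right atoms: `l6_Rx`. -/
theorem l6_Rx (h2 : a₂ ∈ Rt ∨ a₂ = v) : prob p (avoidAll ends a₂ {v}) =
    ratom ends side v a₂ a₃ b p ![false, true, true, false, false, true] + ratom ends side v a₂ a₃ b p ![false, true, false, false, true, false] + ratom ends side v a₂ a₃ b p ![false, true, false, false, false, false] + ratom ends side v a₂ a₃ b p ![false, false, true, true, false, false] + ratom ends side v a₂ a₃ b p ![false, false, true, false, false, false] + ratom ends side v a₂ a₃ b p ![false, false, false, true, true, true] + ratom ends side v a₂ a₃ b p ![false, false, false, true, false, false] + ratom ends side v a₂ a₃ b p ![false, false, false, false, true, false] + ratom ends side v a₂ a₃ b p ![false, false, false, false, false, true] + ratom ends side v a₂ a₃ b p ![false, false, false, false, false, false] := by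
  rw [prob_R6 ends side v a₂ a₃ b p ((avoidAll ends a₂ {v}))
      (fun ρ => ¬ (ρ 0 = true)) (fun ω => by simp only [avoidAll, Set.mem_setOf_eq, Finset.mem_singleton, forall_eq, ro_conn_a₂_v h h2 ω (a₃ := a₃) (b := b)])]
  simp only [sum_ite_ratom_eq_sum_transSix, sum_transSix]
  conv_lhs => simp [Fintype.sum_prod_type]

/-- A quantity of (L6) / the Harris step, in the right atoms: `l6_B`. -/
theorem l6_B (h2 : a₂ ∈ Rt ∨ a₂ = v) (hb : b ∈ Rt ∨ b = v) : prob p (connEvent ends a₂ b) =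
    ratom ends side v a₂ a₃ b p ![true, true, true, true, true, true] + ratom ends side v a₂ a₃ b p ![true, false, true, false, true, false] + ratom ends side v a₂ a₃ b p ![false, true, false, false, true, false] + ratom ends side v a₂ a₃ b p ![false, false, false, true, true, true] + ratom ends side v a₂ a₃ b p ![false, false, false, false, true, false] := by
  rw [prob_R6 ends side v a₂ a₃ b p ((connEvent ends a₂ b))
      (fun ρ => (ρ 4 = true)) (fun ω => by simp only [mem_connEvent, ro_conn_a₂_b h h2 hb ω (a₃ := a₃)])]
  simp only [sum_ite_ratom_eq_sum_transSix, sum_transSix]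
  conv_lhs => simp [Fintype.sum_prod_type]

/-- A quantity of (L6) / the Harris step, in the right atoms: `l6_RxB`. -/
theorem l6_RxB (h2 : a₂ ∈ Rt ∨ a₂ = v) (hb : b ∈ Rt ∨ b = v) : prob p (avoidAll ends a₂ {v} ∩ connEvent ends a₂ b) =
    ratom ends side v a₂ a₃ b p ![false, true, false, false, true, false] + ratom ends side v a₂ a₃ b p ![false, false, false, true, true, true] + ratom ends side v a₂ a₃ b p ![false, false, false, false, true, false] := by
  rw [prob_R6 ends side v a₂ a₃ b p ((avoidAll ends a₂ {v} ∩ connEvent ends a₂ b))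
      (fun ρ => (¬ (ρ 0 = true) ∧ ρ 4 = true)) (fun ω => by simp only [Set.mem_inter_iff, mem_connEvent, avoidAll, Set.mem_setOf_eq, Finset.mem_singleton, forall_eq, ro_conn_a₂_v h h2 ω (a₃ := a₃) (b := b), ro_conn_a₂_b h h2 hb ω (a₃ := a₃)])]
  simp only [sum_ite_ratom_eq_sum_transSix, sum_transSix]
  conv_lhs => simp [Fintype.sum_prod_type]

/-- A quantity of (L6) / the Harris step, in the right atoms: `l6_R3`. -/
theorem l6_R3 (h2 : a₂ ∈ Rt ∨ a₂ = v) (h3 : a₃ ∈ Rt ∨ a₃ = v) : prob p (avoidAll ends a₂ {a₃}) =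
    ratom ends side v a₂ a₃ b p ![true, false, true, false, true, false] + ratom ends side v a₂ a₃ b p ![true, false, false, false, false, true] + ratom ends side v a₂ a₃ b p ![true, false, false, false, false, false] + ratom ends side v a₂ a₃ b p ![false, true, true, false, false, true] + ratom ends side v a₂ a₃ b p ![false, true, false, false, true, false] + ratom ends side v a₂ a₃ b p ![false, true, false, false, false, false] + ratom ends side v a₂ a₃ b p ![false, false, true, false, false, false] + ratom ends side v a₂ a₃ b p ![false, false, false, false, true, false] + ratom ends side v a₂ a₃ b p ![false, false, false, false, false, true] + ratom ends side v a₂ a₃ b p ![false, false, false, false, false, false] := by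
  rw [prob_R6 ends side v a₂ a₃ b p ((avoidAll ends a₂ {a₃}))
      (fun ρ => ¬ (ρ 3 = true)) (fun ω => by simp only [avoidAll, Set.mem_setOf_eq, Finset.mem_singleton, forall_eq, ro_conn_a₂_a₃ h h2 h3 ω (b := b)])]
  simp only [sum_ite_ratom_eq_sum_transSix, sum_transSix]
  conv_lhs => simp [Fintype.sum_prod_type]

/-- A quantity of (L6) / the Harris step, in the right atoms: `l6_RxX3`. -/
theorem l6_RxX3 (h2 : a₂ ∈ Rt ∨ a₂ = v) (h3 : a₃ ∈ Rt ∨ a₃ = v) : prob p (avoidAll ends a₂ {v} ∩ connEvent ends v a₃) =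
    ratom ends side v a₂ a₃ b p ![false, true, true, false, false, true] + ratom ends side v a₂ a₃ b p ![false, true, false, false, true, false] + ratom ends side v a₂ a₃ b p ![false, true, false, false, false, false] := by
  rw [prob_R6 ends side v a₂ a₃ b p ((avoidAll ends a₂ {v} ∩ connEvent ends v a₃))
      (fun ρ => (¬ (ρ 0 = true) ∧ ρ 1 = true)) (fun ω => by simp only [Set.mem_inter_iff, mem_connEvent, avoidAll, Set.mem_setOf_eq, Finset.mem_singleton, forall_eq, ro_conn_a₂_v h h2 ω (a₃ := a₃) (b := b), ro_conn_v_a₃' h h3 ω (a₂ := a₂) (b := b)])]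
  simp only [sum_ite_ratom_eq_sum_transSix, sum_transSix]
  conv_lhs => simp [Fintype.sum_prod_type]

/-- A quantity of (L6) / the Harris step, in the right atoms: `l6_RxX3B`. -/
theorem l6_RxX3B (h2 : a₂ ∈ Rt ∨ a₂ = v) (h3 : a₃ ∈ Rt ∨ a₃ = v) (hb : b ∈ Rt ∨ b = v) : prob p (avoidAll ends a₂ {v} ∩ connEvent ends v a₃ ∩ connEvent ends a₂ b) =
    ratom ends side v a₂ a₃ b p ![false, true, false, false, true, false] := by
  rw [prob_R6 ends side v a₂ a₃ b p ((avoidAll ends a₂ {v} ∩ connEvent ends v a₃ ∩ connEvent ends a₂ b))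
      (fun ρ => ((¬ (ρ 0 = true) ∧ ρ 1 = true) ∧ ρ 4 = true)) (fun ω => by simp only [Set.mem_inter_iff, mem_connEvent, avoidAll, Set.mem_setOf_eq, Finset.mem_singleton, forall_eq, ro_conn_a₂_v h h2 ω (a₃ := a₃) (b := b), ro_conn_v_a₃' h h3 ω (a₂ := a₂) (b := b), ro_conn_a₂_b h h2 hb ω (a₃ := a₃)])]
  simp only [sum_ite_ratom_eq_sum_transSix, sum_transSix]
  conv_lhs => simp [Fintype.sum_prod_type]

/-- A quantity of (L6) / the Harris step, in the right atoms: `hA`. -/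
theorem hA (h2 : a₂ ∈ Rt ∨ a₂ = v) (h3 : a₃ ∈ Rt ∨ a₃ = v) : prob p ((connEvent ends v a₂)ᶜ ∩ (connEvent ends a₃ v)ᶜ) =
    ratom ends side v a₂ a₃ b p ![false, false, true, true, false, false] + ratom ends side v a₂ a₃ b p ![false, false, true, false, false, false] + ratom ends side v a₂ a₃ b p ![false, false, false, true, true, true] + ratom ends side v a₂ a₃ b p ![false, false, false, true, false, false] + ratom ends side v a₂ a₃ b p ![false, false, false, false, true, false] + ratom ends side v a₂ a₃ b p ![false, false, false, false, false, true] + ratom ends side v a₂ a₃ b p ![false, false, false, false, false, false] := by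
  rw [prob_R6 ends side v a₂ a₃ b p (((connEvent ends v a₂)ᶜ ∩ (connEvent ends a₃ v)ᶜ))
      (fun ρ => (¬ (ρ 0 = true) ∧ ¬ (ρ 1 = true))) (fun ω => by simp only [Set.mem_inter_iff, Set.mem_compl_iff, mem_connEvent, ro_conn_v_a₂ h h2 ω (a₃ := a₃) (b := b), ro_conn_a₃_v h h3 ω (a₂ := a₂) (b := b)])]
  simp only [sum_ite_ratom_eq_sum_transSix, sum_transSix]
  conv_lhs => simp [Fintype.sum_prod_type]

/-- A quantity of (L6) / the Harris step, in the right atoms: `hB3`. -/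
theorem hB3 (h2 : a₂ ∈ Rt ∨ a₂ = v) (h3 : a₃ ∈ Rt ∨ a₃ = v) : prob p (connEvent ends a₃ a₂) =
    ratom ends side v a₂ a₃ b p ![true, true, true, true, true, true] + ratom ends side v a₂ a₃ b p ![true, true, false, true, false, false] + ratom ends side v a₂ a₃ b p ![false, false, true, true, false, false] + ratom ends side v a₂ a₃ b p ![false, false, false, true, true, true] + ratom ends side v a₂ a₃ b p ![false, false, false, true, false, false] := by
  rw [prob_R6 ends side v a₂ a₃ b p ((connEvent ends a₃ a₂))
      (fun ρ => (ρ 3 = true)) (fun ω => by simp only [mem_connEvent, ro_conn_a₃_a₂ h h2 h3 ω (b := b)])]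
  simp only [sum_ite_ratom_eq_sum_transSix, sum_transSix]
  conv_lhs => simp [Fintype.sum_prod_type]

/-- A quantity of (L6) / the Harris step, in the right atoms: `hAB`. -/
theorem hAB (h2 : a₂ ∈ Rt ∨ a₂ = v) (h3 : a₃ ∈ Rt ∨ a₃ = v) : prob p (((connEvent ends v a₂)ᶜ ∩ (connEvent ends a₃ v)ᶜ) ∩ connEvent ends a₃ a₂) =
    ratom ends side v a₂ a₃ b p ![false, false, true, true, false, false] + ratom ends side v a₂ a₃ b p ![false, false, false, true, true, true] + ratom ends side v a₂ a₃ b p ![false, false, false, true, false, false] := by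
  rw [prob_R6 ends side v a₂ a₃ b p ((((connEvent ends v a₂)ᶜ ∩ (connEvent ends a₃ v)ᶜ) ∩ connEvent ends a₃ a₂))
      (fun ρ => ((¬ (ρ 0 = true) ∧ ¬ (ρ 1 = true)) ∧ ρ 3 = true)) (fun ω => by simp only [Set.mem_inter_iff, Set.mem_compl_iff, mem_connEvent, ro_conn_v_a₂ h h2 ω (a₃ := a₃) (b := b), ro_conn_a₃_v h h3 ω (a₂ := a₂) (b := b), ro_conn_a₃_a₂ h h2 h3 ω (b := b)])]
  simp only [sum_ite_ratom_eq_sum_transSix, sum_transSix]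
  conv_lhs => simp [Fintype.sum_prod_type]

/-- **`γₒ(1) = 2 [r²·(L6) + n₃ r α_b + P(Q′, bL)(D′ b₃ − n₃ π)]`** (MINE2-CUTVERTEX §13.13), an exact
identity in the right atoms. -/
theorem gamma1_ro_eq (h2 : a₂ ∈ Rt ∨ a₂ = v) (h3 : a₃ ∈ Rt ∨ a₃ = v) (hb : b ∈ Rt ∨ b = v) :
    2 * (prob p {ω | ¬ Conn ends ω v a₂} * prob p {ω | ¬ Conn ends ω v a₂ ∧ ¬ (Conn ends ω a₃ v ∨ Conn ends ω a₃ a₂)} * prob p {ω | Conn ends ω b a₂} + prob p {ω | ¬ Conn ends ω a₃ a₂} * prob p {ω | ¬ Conn ends ω v a₂} * (prob p {ω | ¬ Conn ends ω v a₂ ∧ Conn ends ω b v ∧ Conn ends ω a₃ a₂} - prob p {ω | ¬ Conn ends ω v a₂ ∧ Conn ends ω b a₂ ∧ ¬ Conn ends ω a₃ v}) + (prob p {ω | ¬ Conn ends ω v a₂ ∧ Conn ends ω b v} - prob p {ω | ¬ Conn ends ω v a₂ ∧ Conn ends ω b a₂}) * (prob p {ω | ¬ Conn ends ω v a₂ ∧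 ¬ (Conn ends ω a₃ v ∨ Conn ends ω a₃ a₂)} * prob p {ω | Conn ends ω a₃ a₂} - prob p {ω | ¬ Conn ends ω a₃ a₂} * prob p {ω | ¬ Conn ends ω v a₂ ∧ Conn ends ω a₃ a₂})) =
    2 * ((prob p {ω | ¬ Conn ends ω v a₂ ∧ ¬ (Conn ends ω a₃ v ∨ Conn ends ω a₃ a₂)} * (prob p {ω | ¬ Conn ends ω v a₂} * prob p {ω | Conn ends ω b a₂} - prob p {ω | ¬ Conn ends ω v a₂ ∧ Conn ends ω b a₂}) -
        prob p {ω | ¬ Conn ends ω a₃ a₂} * (prob p {ω | ¬ Conn ends ω v a₂ ∧ Conn ends ω b a₂} * prob p {ω | ¬ Conn ends ω v a₂ ∧ Conn ends ω a₃ v} - prob p {ω | ¬ Conn ends ω v a₂} * prob p {ω | ¬ Conn ends ω v a₂ ∧ Conn ends ω b a₂ ∧ Conn ends ω a₃ v})) +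
      prob p {ω | ¬ Conn ends ω a₃ a₂} * prob p {ω | ¬ Conn ends ω v a₂} * prob p {ω | ¬ Conn ends ω v a₂ ∧ Conn ends ω b v ∧ Conn ends ω a₃ a₂} +
      prob p {ω | ¬ Conn ends ω v a₂ ∧ Conn ends ω b v} * (prob p {ω | ¬ Conn ends ω v a₂ ∧ ¬ (Conn ends ω a₃ v ∨ Conn ends ω a₃ a₂)} * prob p {ω | Conn ends ω a₃ a₂} - prob p {ω | ¬ Conn ends ω a₃ a₂} * prob p {ω | ¬ Conn ends ω v a₂ ∧ Conn ends ω a₃ a₂})) := by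
  have hr := ratom_sum_transSix ends side v a₂ a₃ b p
  rw [sum_transSix] at hr
  have hrs : ratom ends side v a₂ a₃ b p ![false, false, false, false, false, false] = 1 - (ratom ends side v a₂ a₃ b p ![true, true, true, true, true, true] + ratom ends side v a₂ a₃ b p ![true, true, false, true, false, false] + ratom ends side v a₂ a₃ b p ![true, false, true, false, true, false] + ratom ends side v a₂ a₃ b p ![true, false, false, false, false, true] + ratom ends side v a₂ a₃ b p ![true, false, false, false, false, false] + ratom ends side v a₂ a₃ b p ![false, true, true, false, false, true] + ratom ends side v a₂ a₃ b p ![false, true, false, false, true, false] + ratom ends side v a₂ a₃ b p ![false, true, false, false, false, false] + ratom ends side v a₂ a₃ b p ![false, false, true, true, false, false] + ratom ends side v a₂ a₃ b p ![false, false, true, false, false, false] + ratom ends side v a₂ a₃ b p ![false, false, false, true, true, true] + ratom ends side v a₂ a₃ b p ![false, false, false, true, false, false] + ratom ends side v a₂ a₃ b p ![false, false, false, false, true, false] + ratom ends side v a₂ a₃ b p ![false, false, false, false, false, true]) := by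
    linear_combination hr
  rw [eo_n3 h p h2 h3 (a₃ := a₃) (b := b),
    eo_PQp h p h2 (a₃ := a₃) (b := b),
    eo_bb h p h2 hb (a₃ := a₃) (b := b),
    eo_b3 h p h2 h3 (a₃ := a₃) (b := b),
    eo_alphab h p h2 h3 hb (a₃ := a₃) (b := b),
    eo_betab h p h2 h3 hb (a₃ := a₃) (b := b),
    eo_Dp h p h2 h3 (a₃ := a₃) (b := b),
    eo_QbL h p h2 hb (a₃ := a₃) (b := b),
    eo_QbH h p h2 hb (a₃ := a₃) (b := b),
    eo_pi h p h2 h3 (a₃ := a₃) (b := b),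
    eo_3L h p h2 h3 (a₃ := a₃) (b := b),
    eo_bH3L h p h2 h3 hb (a₃ := a₃) (b := b), hrs]
  ring

/-- The seven probabilities of (L6) in this file's notation: the cleared (L6) equals the first
bracket of `gamma1_ro_eq`. -/
theorem l6_eq [DecidableEq V] (h2 : a₂ ∈ Rt ∨ a₂ = v) (h3 : a₃ ∈ Rt ∨ a₃ = v) (hb : b ∈ Rt ∨ b = v) :
    prob p (avoidAll ends a₂ {v, a₃} ∩ (connEvent ends v a₃)ᶜ) *
        (prob p (avoidAll ends a₂ {v}) * prob p (connEvent ends a₂ b) -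
          prob p (avoidAll ends a₂ {v} ∩ connEvent ends a₂ b)) -
      prob p (avoidAll ends a₂ {a₃}) *
        (prob p (avoidAll ends a₂ {v} ∩ connEvent ends a₂ b) *
            prob p (avoidAll ends a₂ {v} ∩ connEvent ends v a₃) -
          prob p (avoidAll ends a₂ {v}) *
            prob p (avoidAll ends a₂ {v} ∩ connEvent ends v a₃ ∩ connEvent ends a₂ b)) =
    prob p {ω | ¬ Conn ends ω v a₂ ∧ ¬ (Conn ends ω a₃ v ∨ Conn ends ω a₃ a₂)} * (prob p {ω | ¬ Conn ends ω v a₂} * prob p {ω | Conn ends ω b a₂} - prob p {ω | ¬ Conn ends ω v a₂ ∧ Conn ends ω b a₂}) -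
        prob p {ω | ¬ Conn ends ω a₃ a₂} * (prob p {ω | ¬ Conn ends ω v a₂ ∧ Conn ends ω b a₂} * prob p {ω | ¬ Conn ends ω v a₂ ∧ Conn ends ω a₃ v} - prob p {ω | ¬ Conn ends ω v a₂} * prob p {ω | ¬ Conn ends ω v a₂ ∧ Conn ends ω b a₂ ∧ Conn ends ω a₃ v}) := by
  have hr := ratom_sum_transSix ends side v a₂ a₃ b p
  rw [sum_transSix] at hr
  have hrs : ratom ends side v a₂ a₃ b p ![false, false, false, false, false, false] = 1 - (ratom ends side v a₂ a₃ b p ![true, true, true, true, true, true] + ratom ends side v a₂ a₃ b p ![true, true, false, true, false, false] + ratom ends side v a₂ a₃ b p ![true, false, true, false, true, false] + ratom ends side v a₂ a₃ b p ![true, false, false, false, false, true] + ratom ends side v a₂ a₃ b p ![true, false, false, false, false, false] + ratom ends side v a₂ a₃ b p ![false, true, true, false, false, true] + ratom ends side v a₂ a₃ b p ![false, true, false, false, true, false] + ratom ends side v a₂ a₃ b p ![false, true, false, false, false, false] + ratom ends side v a₂ a₃ b p ![false, false, true, true, false, false] + ratom ends side v a₂ a₃ b p ![false, false, true, false, false,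 false] + ratom ends side v a₂ a₃ b p ![false, false, false, true, true, true] + ratom ends side v a₂ a₃ b p ![false, false, false, true, false, false] + ratom ends side v a₂ a₃ b p ![false, false, false, false, true, false] + ratom ends side v a₂ a₃ b p ![false, false, false, false, false, true]) := by
    linear_combination hr
  rw [l6_Rx3N h p h2 h3 (a₃ := a₃) (b := b),
    l6_Rx h p h2 (a₃ := a₃) (b := b),
    l6_B h p h2 hb (a₃ := a₃) (b := b),
    l6_RxB h p h2 hb (a₃ := a₃) (b := b),
    l6_R3 h p h2 h3 (a₃ := a₃) (b := b),
    l6_RxX3 h p h2 h3 (a₃ := a₃) (b := b),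
    l6_RxX3B h p h2 h3 hb (a₃ := a₃) (b := b),
    eo_PQp h p h2 (a₃ := a₃) (b := b),
    eo_bb h p h2 hb (a₃ := a₃) (b := b),
    eo_Dp h p h2 h3 (a₃ := a₃) (b := b),
    eo_QbH h p h2 hb (a₃ := a₃) (b := b),
    eo_n3 h p h2 h3 (a₃ := a₃) (b := b),
    eo_3L h p h2 h3 (a₃ := a₃) (b := b),
    eo_bH3L h p h2 h3 hb (a₃ := a₃) (b := b), hrs]

/-- **`D′ b₃ − n₃ π ≥ 0`** (Harris: `A = {v ↮ a₂, a₃ ↮ v}` decreasing, `B = {a₃ ↔ a₂}`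
increasing; `D′ = P(A) − P(A ∩ B)`, `π = P(A ∩ B)`, `n₃ = 1 − b₃` in the atoms). -/
theorem M_ro_nonneg [LinearOrder R] [IsStrictOrderedRing R] (h2 : a₂ ∈ Rt ∨ a₂ = v)
    (h3 : a₃ ∈ Rt ∨ a₃ = v) (hb : b ∈ Rt ∨ b = v) (hp : IsProbVec p) :
    0 ≤ prob p {ω | ¬ Conn ends ω v a₂ ∧ ¬ (Conn ends ω a₃ v ∨ Conn ends ω a₃ a₂)} * prob p {ω | Conn ends ω a₃ a₂} - prob p {ω | ¬ Conn ends ω a₃ a₂} * prob p {ω | ¬ Conn ends ω v a₂ ∧ Conn ends ω a₃ a₂} := by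
  have _hb := hb
  have hH := prob_inter_le_prob_mul_prob_of_isLowerSet hp
    ((isUpperSet_connEvent ends v a₂).compl.inter (isUpperSet_connEvent ends a₃ v).compl)
    (isUpperSet_connEvent ends a₃ a₂)
  have hr := ratom_sum_transSix ends side v a₂ a₃ b p
  rw [sum_transSix] at hr
  have hrs : ratom ends side v a₂ a₃ b p ![false, false, false, false, false, false] = 1 - (ratom ends side v a₂ a₃ b p ![true, true, true, true, true, true] + ratom ends side v a₂ a₃ b p ![true, true, false, true, false, false] + ratom ends side v a₂ a₃ b p ![true, false, true, false, true, false] + ratom ends side v a₂ a₃ b p ![true, false, false, false, false, true] + ratom ends side v a₂ a₃ b p ![true, false, false, false, false, false] + ratom ends side v a₂ a₃ b p ![false, true, true, false, false, true] + ratom ends side v a₂ a₃ b p ![false, true, false, false, true, false] + ratom ends side v a₂ a₃ b p ![false, true, false, false, false, false] + ratom ends side v a₂ a₃ b p ![false, false, true, true, false, false] + ratom ends side v a₂ a₃ b p ![false, false, true, false, false, false] + ratom ends side v a₂ a₃ b p ![false, false, false, true, true, true] + ratom ends side v a₂ a₃ b p ![false, false, false, true, false, false] + ratom ends side v a₂ a₃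 b p ![false, false, false, false, true, false] + ratom ends side v a₂ a₃ b p ![false, false, false, false, false, true]) := by
    linear_combination hr
  rw [hAB h p h2 h3 (b := b), hA h p h2 h3 (b := b), hB3 h p h2 h3 (b := b)] at hH
  rw [eo_Dp h p h2 h3 (a₃ := a₃) (b := b), eo_b3 h p h2 h3 (a₃ := a₃) (b := b), eo_n3 h p h2 h3 (a₃ := a₃) (b := b), eo_pi h p h2 h3 (a₃ := a₃) (b := b)]
  rw [hrs] at hH ⊢
  nlinarith [hH]

/-- **`γₒ(1) ≥ 0`**: (L6) in the kernel, a product of probabilities, and Harris. -/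
theorem gamma1_ro_nonneg [Fintype V] [DecidableEq V] [LinearOrder R] [IsStrictOrderedRing R]
    (h2 : a₂ ∈ Rt ∨ a₂ = v) (h3 : a₃ ∈ Rt ∨ a₃ = v) (hb : b ∈ Rt ∨ b = v) (hp : IsProbVec p) :
    0 ≤ 2 * (prob p {ω | ¬ Conn ends ω v a₂} * prob p {ω | ¬ Conn ends ω v a₂ ∧ ¬ (Conn ends ω a₃ v ∨ Conn ends ω a₃ a₂)} * prob p {ω | Conn ends ω b a₂} + prob p {ω | ¬ Conn ends ω a₃ a₂} * prob p {ω | ¬ Conn ends ω v a₂} * (prob p {ω | ¬ Conn ends ω v a₂ ∧ Conn ends ω b v ∧ Conn ends ω a₃ a₂} - prob p {ω | ¬ Conn ends ω v a₂ ∧ Conn ends ω b a₂ ∧ ¬ Conn ends ω a₃ v}) + (prob p {ω | ¬ Conn ends ω v a₂ ∧ Conn ends ω b v} - prob p {ω | ¬ Conn ends ω v a₂ ∧ Conn ends ω b a₂}) * (prob p {ω | ¬ Conn ends ω v a₂ ∧ ¬ (Conn ends ω a₃ v ∨ Conn ends ω a₃ a₂)} * prob p {ω | Conn ends ω a₃ a₂}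 - prob p {ω | ¬ Conn ends ω a₃ a₂} * prob p {ω | ¬ Conn ends ω v a₂ ∧ Conn ends ω a₃ a₂})) := by
  have key := RootLeafO.rootleaf_o_nonneg p hp ends a₂ v a₃ b
  dsimp only at key
  rw [l6_eq h p h2 h3 hb (a₃ := a₃) (b := b)] at key
  have hM := M_ro_nonneg h p h2 h3 hb hp
  have h1 := prob_nonneg hp {ω : Config E | ¬ Conn ends ω a₃ a₂}
  have h2' := prob_nonneg hp {ω : Config E | ¬ Conn ends ω v a₂}
  have h3' := prob_nonneg hp {ω : Config E | ¬ Conn ends ω v a₂ ∧ Conn ends ω b v ∧ Conn ends ω a₃ a₂}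
  have h4 := prob_nonneg hp {ω : Config E | ¬ Conn ends ω v a₂ ∧ Conn ends ω b v}
  rw [gamma1_ro_eq h p h2 h3 hb]
  have h6 : (0 : R) ≤ 2 := by norm_num
  exact mul_nonneg h6 (add_nonneg (add_nonneg key (mul_nonneg (mul_nonneg h1 h2') h3')) (mul_nonneg h4 hM))

/-- **(HCOV) with a root and `o` behind a cut vertex** — the fifth two-far-mark class of S3.5 in
the kernel, unconditionally, every admissible weight vector. -/
theorem HCov_a1oFar [Fintype V] [DecidableEq V] [LinearOrder R] [IsStrictOrderedRing R]
    (h1 : a₁ ∈ L ∨ a₁ = v) (ho : o ∈ L ∨ o = v) (h2 : a₂ ∈ Rt ∨ a₂ = v) (h3 : a₃ ∈ Rt ∨ a₃ = v)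
    (hb : b ∈ Rt ∨ b = v) (hp : IsProbVec p) : HCov p ends o a₁ a₂ a₃ b :=
  HCov_a1oFar_of_gamma1 h p h1 ho h2 h3 hb hp (gamma1_ro_nonneg h p h2 h3 hb hp)

end ROFull

end CutTwoFar

end Summit.Ventures.PercRepro2
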